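import Summits.ABC.ABC.Theses.IsogenyGlueCongruence
import Literature.NumberTheory.EllipticCurves.SzpiroFreyCurveProofs
import Literature.NumberTheory.EllipticCurves.SzpiroOfAbcProofs
import Literature.NumberTheory.EllipticCurves.DegreeConjectureAbcMurtyProofs
import Literature.NumberTheory.DiophantineGeometry.EllArithGlueProofs

/-!
# `PolyHeightOfBoundedPrimes` (stmt-ABC-16006, crux B'), line `Sketch` (card `archimedean-hall-split`)
— calibration stub `stub_polyHallDelta_frey`: the Hall half is void on the Frey locus

The line splits the consequent `H` of B' into a finite half `PolySzpiroΔ` and an archimedean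
"Hall half" `PolyHallΔ : |c₄(W)|³ ≤ C · |Δ_W|^{σ'}` over semistable global minimal elliptic `W/ℚ`.
This file certifies that ON THE FREY LOCUS the Hall half holds identically with `σ' = 3/2`
(and `C = 2²⁰`): for a Serre-normalised pair (`A, B` coprime, `AB(A+B) ≠ 0`, `A ≡ −1 (mod 4)`,
`32 ∣ B`) and ANY global minimal model `W = C • freyCurve A B` of the Frey curve
`y² = x(x − A)(x + B)`,

* `abs_Δ_eq_of_smul_freyCurve` : `|Δ_W| = (AB(A+B))² / 2⁸`
  (`minimalDiscriminantNorm_freyCurve_of_mod_holds`, isomorphism invariance of `Δ_min`, and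
  `Δ_min = |Δ_W|` for a global minimal `W`);
* `abs_c₄_pow_three_eq_of_smul_freyCurve`, `abs_c₄_eq_of_smul_freyCurve` :
  `|c₄(W)|³ = (A² + AB + B²)³`, `|c₄(W)| = A² + AB + B²` (transport of `c₄³/Δ` along `C`,
  `c₄(frey) = 16(A² + AB + B²)`, `Δ(frey) = 16(AB(A+B))²`);
* `sq_add_mul_add_sq_le` : `A² + AB + B² ≤ 5·|AB(A+B)|` for nonzero `A, B, A + B`;
* `stub_polyHallDelta_frey` (registered signature, verbatim) and its curried form
  `polyHallDelta_frey` : `|c₄(W)|³ ≤ 2²⁰ · |Δ_W|^{3/2}`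
  (indeed `(A²+AB+B²)³ ≤ 125·|AB(A+B)|³ = 125·2¹²·|Δ_W|^{3/2}`).

So Frey-scoped routes never meet the Hall half; no Theses statement is asserted.
-/

noncomputable section

-- single-conjunct summit ABC: the duplicate ABC.ABC is mandated (CONVENTIONS §2)
set_option linter.dupNamespace false

namespace Summit.ABC.ABC.Theorems.PolyHeightOfBoundedPrimes.HallSplit

open WeierstrassCurve IsDedekindDomain
open Literature.NumberTheory.EllipticCurves
open Summit.ABC.ABC.Theses.IsogenyGlueCongruence

/-- **Minimal discriminant of the normalised Frey curve, on any global minimal model.** For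
`A, B` coprime, `AB(A+B) ≠ 0`, `A ≡ −1 (mod 4)`, `32 ∣ B` and `W = C • freyCurve A B` globally
minimal: `|Δ_W| = (AB(A+B))²/2⁸` (Serre 1987 §4.1; B–G Ex. 12.5.10 (a); `Δ_min` is an isomorphism
invariant and equals `|Δ|` of a global minimal equation, Silverman AEC VIII.8).
[cite: BombieriGubler2006, Ex. 12.5.10] -/
theorem abs_Δ_eq_of_smul_freyCurve (A B : ℤ) (hAB : IsCoprime A B) (h0 : A * B * (A + B) ≠ 0)
    (hA : A ≡ -1 [ZMOD 4]) (hB : (32 : ℤ) ∣ B) (W : WeierstrassCurve ℚ) [W.IsElliptic]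
    [W.IsGloballyMinimal] (hW : ∃ C : VariableChange ℚ, C • freyCurve A B = W) :
    (|W.Δ| : ℚ) = ((A : ℚ) * B * (A + B)) ^ 2 / 2 ^ 8 := by
  obtain ⟨C, hCW⟩ := hW
  have hD : 2 ^ 8 * (freyCurve A B).minimalDiscriminantNorm ℤ = ((A * B * (A + B)) ^ 2).natAbs :=
    minimalDiscriminantNorm_freyCurve_of_mod_holds A B hAB h0 hA hB
  have hWD : W.minimalDiscriminantNorm ℤ = (freyCurve A B).minimalDiscriminantNorm ℤ := by
    rw [← hCW, WeierstrassCurve.minimalDiscriminantNorm_smul_rat]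
  have hΔ : (|W.Δ| : ℚ) = ((W.minimalDiscriminantNorm ℤ : ℕ) : ℚ) := by
    rw [WeierstrassCurve.minimalDiscriminantNorm_int_eq_natAbs_minimalDiscriminantInt_holds W,
      Nat.cast_natAbs, Int.cast_abs, WeierstrassCurve.cast_minimalDiscriminantInt W]
  have h := congrArg (fun n : ℕ ↦ (n : ℚ)) hD
  simp only [Nat.cast_mul, Nat.cast_pow, Nat.cast_ofNat, Nat.cast_natAbs] at h
  rw [hΔ, hWD, eq_div_iff (by norm_num), mul_comm, h]
  push_cast
  exact abs_of_nonneg (sq_nonneg _)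

/-- **`|c₄|³` of a global minimal model of the normalised Frey curve.** With `A, B, W` as in
`abs_Δ_eq_of_smul_freyCurve`: `|c₄(W)|³ = (A² + AB + B²)³` — transport `|c₄(W)|³·|Δ(frey)| =
|Δ(W)|·|c₄(frey)|³` along `C` (`c₄ ↦ u⁻⁴c₄`, `Δ ↦ u⁻¹²Δ`), `c₄(frey) = 16(A²+AB+B²)`,
`Δ(frey) = 16(AB(A+B))²`, `|Δ(W)| = (AB(A+B))²/2⁸`. [cite: BombieriGubler2006, Ex. 12.5.10] -/
theorem abs_c₄_pow_three_eq_of_smul_freyCurve (A B : ℤ) (hAB : IsCoprime A B)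
    (h0 : A * B * (A + B) ≠ 0) (hA : A ≡ -1 [ZMOD 4]) (hB : (32 : ℤ) ∣ B)
    (W : WeierstrassCurve ℚ) [W.IsElliptic] [W.IsGloballyMinimal]
    (hW : ∃ C : VariableChange ℚ, C • freyCurve A B = W) :
    |W.c₄| ^ 3 = ((A : ℚ) ^ 2 + A * B + B ^ 2) ^ 3 := by
  have hΔW := abs_Δ_eq_of_smul_freyCurve A B hAB h0 hA hB W hW
  obtain ⟨C, hCW⟩ := hW
  have hc₄ : W.c₄ = ((C.u⁻¹ : ℚˣ) : ℚ) ^ 4 * (freyCurve A B).c₄ := by rw [← hCW, variableChange_c₄]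
  have hΔu : W.Δ = ((C.u⁻¹ : ℚˣ) : ℚ) ^ 12 * (freyCurve A B).Δ := by rw [← hCW, variableChange_Δ]
  have hP0 : (A : ℚ) * B * (A + B) ≠ 0 := by exact_mod_cast h0
  have hP : (0 : ℚ) < ((A : ℚ) * B * (A + B)) ^ 2 := by positivity
  have hB0 : (B : ℚ) ≠ 0 := by
    have : B ≠ 0 := fun h => h0 (by rw [h]; ring)
    exact_mod_cast this
  have hQ : (0 : ℚ) < (A : ℚ) ^ 2 + A * B + B ^ 2 := by
    have h1 : (0 : ℚ) < (B : ℚ) ^ 2 := by positivity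
    nlinarith [sq_nonneg (2 * (A : ℚ) + B)]
  -- `|c₄(W)|³ · |Δ(frey)| = |Δ(W)| · |c₄(frey)|³` (both are `|u|⁻¹² |c₄(frey)|³ |Δ(frey)|`)
  have hI : |W.c₄| ^ 3 * |(freyCurve A B).Δ| = |W.Δ| * |(freyCurve A B).c₄| ^ 3 := by
    rw [hc₄, hΔu]
    simp only [abs_mul, abs_pow]
    ring
  have h1 : |(freyCurve A B).Δ| = 16 * ((A : ℚ) * B * (A + B)) ^ 2 := by
    rw [freyCurve_Δ, abs_of_pos (mul_pos (by norm_num) hP)]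
  have h2 : |(freyCurve A B).c₄| = 16 * ((A : ℚ) ^ 2 + A * B + B ^ 2) := by
    rw [freyCurve_c₄, abs_of_pos (mul_pos (by norm_num) hQ)]
  rw [h1, h2, hΔW] at hI
  have hI' : |W.c₄| ^ 3 * (16 * ((A : ℚ) * B * (A + B)) ^ 2) =
      ((A : ℚ) ^ 2 + A * B + B ^ 2) ^ 3 * (16 * ((A : ℚ) * B * (A + B)) ^ 2) := by
    rw [hI]; ring
  exact mul_right_cancel₀ (mul_ne_zero (by norm_num) hP.ne') hI'

/-- **`|c₄|` of a global minimal model of the normalised Frey curve** is exactly `A² + AB + B²`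
(cube root of `abs_c₄_pow_three_eq_of_smul_freyCurve`; both sides are nonnegative).
[cite: BombieriGubler2006, Ex. 12.5.10] -/
theorem abs_c₄_eq_of_smul_freyCurve (A B : ℤ) (hAB : IsCoprime A B)
    (h0 : A * B * (A + B) ≠ 0) (hA : A ≡ -1 [ZMOD 4]) (hB : (32 : ℤ) ∣ B)
    (W : WeierstrassCurve ℚ) [W.IsElliptic] [W.IsGloballyMinimal]
    (hW : ∃ C : VariableChange ℚ, C • freyCurve A B = W) :
    |W.c₄| = (A : ℚ) ^ 2 + A * B + B ^ 2 := by
  have h3 := abs_c₄_pow_three_eq_of_smul_freyCurve A B hAB h0 hA hB W hW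
  have hQ : (0 : ℚ) ≤ (A : ℚ) ^ 2 + A * B + B ^ 2 := by nlinarith [sq_nonneg ((A : ℚ) + B)]
  exact (pow_left_inj₀ (abs_nonneg _) hQ three_ne_zero).mp h3

/-- **Elementary size comparison** `A² + AB + B² ≤ 5·|AB(A+B)|` for nonzero integers `A, B, A + B`
(`A² = |A|·|A| ≤ |A|(|A+B| + |B|) ≤ 2|A||B||A+B|`, likewise for `B²`, and `AB ≤ |A||B| ≤ |AB(A+B)|`).
[folklore] -/
theorem sq_add_mul_add_sq_le (A B : ℤ) (h0 : A * B * (A + B) ≠ 0) :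
    A ^ 2 + A * B + B ^ 2 ≤ 5 * |A * B * (A + B)| := by
  have hA0 : A ≠ 0 := fun h => h0 (by rw [h]; ring)
  have hB0 : B ≠ 0 := fun h => h0 (by rw [h]; ring)
  have hS0 : A + B ≠ 0 := fun h => h0 (by rw [h]; ring)
  have ha : 1 ≤ |A| := Int.one_le_abs hA0
  have hb : 1 ≤ |B| := Int.one_le_abs hB0
  have hs : 1 ≤ |A + B| := Int.one_le_abs hS0
  have h1 : |A| ≤ |A + B| + |B| := by
    calc |A| = |(A + B) - B| := by ring_nf
      _ ≤ |A + B| + |B| := abs_sub _ _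
  have h2 : |B| ≤ |A + B| + |A| := by
    calc |B| = |(A + B) - A| := by ring_nf
      _ ≤ |A + B| + |A| := abs_sub _ _
  have hAB : A * B ≤ |A| * |B| := by rw [← abs_mul]; exact le_abs_self _
  rw [abs_mul, abs_mul, ← sq_abs A, ← sq_abs B]
  nlinarith [mul_le_mul_of_nonneg_left h1 (abs_nonneg A), mul_le_mul_of_nonneg_left h2 (abs_nonneg B),
    mul_nonneg (sub_nonneg.mpr hb) (mul_nonneg (abs_nonneg A) (abs_nonneg (A + B))),
    mul_nonneg (sub_nonneg.mpr ha) (mul_nonneg (abs_nonneg B) (abs_nonneg (A + B))),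
    mul_nonneg (sub_nonneg.mpr hs) (mul_nonneg (abs_nonneg A) (abs_nonneg B))]

/-- **The Hall half on the Frey locus, `σ' = 3/2` (curried form).** For a Serre-normalised pair
`A, B` and any global minimal model `W` of `freyCurve A B`: `|c₄(W)|³ ≤ 2²⁰ · |Δ_W|^{3/2}`
(`|c₄(W)|³ = (A²+AB+B²)³ ≤ 125·|AB(A+B)|³` and `|AB(A+B)|³ = 2¹²·|Δ_W|^{3/2}`). [cite: Frey1986] -/
theorem polyHallDelta_frey (A B : ℤ) (hAB : IsCoprime A B) (h0 : A * B * (A + B) ≠ 0)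
    (hA : A ≡ -1 [ZMOD 4]) (hB : (32 : ℤ) ∣ B) (W : WeierstrassCurve ℚ) [W.IsElliptic]
    [W.IsGloballyMinimal] (hW : ∃ C : VariableChange ℚ, C • freyCurve A B = W) :
    ((|W.c₄| ^ 3 : ℚ) : ℝ) ≤ 2 ^ 20 * ((|W.Δ| : ℚ) : ℝ) ^ (3 / 2 : ℝ) := by
  rw [abs_c₄_pow_three_eq_of_smul_freyCurve A B hAB h0 hA hB W hW,
    abs_Δ_eq_of_smul_freyCurve A B hAB h0 hA hB W hW]
  have hkey : ((A ^ 2 + A * B + B ^ 2 : ℤ) : ℝ) ≤ ((5 * |A * B * (A + B)| : ℤ) : ℝ) := by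
    exact_mod_cast sq_add_mul_add_sq_le A B h0
  push_cast at hkey ⊢
  set Q : ℝ := (A : ℝ) ^ 2 + A * B + B ^ 2 with hQdef
  set P : ℝ := (A : ℝ) * B * (A + B) with hPdef
  have hQ0 : 0 ≤ Q := by rw [hQdef]; nlinarith [sq_nonneg ((A : ℝ) + B)]
  set t : ℝ := |P| / 16 with ht
  have ht0 : 0 ≤ t := by positivity
  have hD : P ^ 2 / 2 ^ 8 = t ^ 2 := by rw [ht, div_pow, sq_abs]; norm_num
  have hrpow : (t ^ 2) ^ (3 / 2 : ℝ) = t ^ 3 := by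
    rw [← Real.rpow_two, ← Real.rpow_mul ht0]
    norm_num
  rw [hD, hrpow]
  calc Q ^ 3 ≤ (5 * |P|) ^ 3 := pow_le_pow_left₀ hQ0 hkey 3
    _ = 125 * 2 ^ 12 * t ^ 3 := by rw [ht]; ring
    _ ≤ 2 ^ 20 * t ^ 3 := by nlinarith [pow_nonneg ht0 3]

/-- **CALIBRATION STUB `stub_polyHallDelta_frey` (registered signature, verbatim).** On the Frey
locus the Hall half `PolyHallΔ` holds identically with `σ' = 3/2`, `C = 2²⁰`: every global minimal
model `W` of the normalised Frey curve `freyCurve A B` satisfies `|c₄(W)|³ ≤ 2²⁰ · |Δ_W|^{3/2}` —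
so Frey-scoped routes never meet the Hall half. [cite: Frey1986] -/
theorem stub_polyHallDelta_frey :
    ∀ A B : ℤ, IsCoprime A B → A * B * (A + B) ≠ 0 → A ≡ -1 [ZMOD 4] → (32 : ℤ) ∣ B →
      ∀ (W : WeierstrassCurve ℚ) [W.IsElliptic] [W.IsGloballyMinimal],
        (∃ C : WeierstrassCurve.VariableChange ℚ, C • freyCurve A B = W) →
          ((|W.c₄| ^ 3 : ℚ) : ℝ) ≤ 2 ^ 20 * ((|W.Δ| : ℚ) : ℝ) ^ (3 / 2 : ℝ) :=
  fun A B hAB h0 hA hB W _ _ hW => polyHallDelta_frey A B hAB h0 hA hB W hW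

end Summit.ABC.ABC.Theorems.PolyHeightOfBoundedPrimes.HallSplit

end
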